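import Mathlib
import HarnessLib

/-!
# The sumcheck protocol over a field, with sums over a subset `H ⊆ F` and an oracle prover (LFKN; BFL/BFLS form)

Literature / complexity toolkit, companion of `SumcheckCNF.lean` (the Lund–Fortnow–Karloff–Nisan
sumcheck for the arithmetization of a CNF over `ℤ`, sums over the Boolean cube). The verifiers of
`MIP = NEXP` (Babai–Fortnow–Lund 1991, §4) and of the polylogarithmic-time proof checking of
Babai–Fortnow–Levin–Szegedy 1991 run the same protocol in the generality needed for low-degree
EXTENSIONS: the claim is `∑_{c ∈ Hᴷ} Φ(c) = v` for a finite subset `H` of a field `F` and a summand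
`Φ : Fᴷ → F` that is a polynomial of degree `≤ D` in each coordinate separately (Arora–Barak 2009,
§8.3.2 "Sumcheck protocol", general form: "`X₁ ∈ H, …, Xₙ ∈ H`" is literally the Boolean case; the
`H`-version is the one of §8.6 / BFLS), and the prover is a TABLE answering each challenge prefix
with a univariate polynomial (the non-interactive / oracle form used inside probabilistically
checkable proofs). This file proves, as pure algebra and counting:

* `SumcheckF.cubeSum H t G = ∑_{c ∈ Hᵗ} G(c)` (lists of coordinates), `psum` (partial sums with a
  fixed prefix), `AxisPoly Φ K D` (coordinatewise degree `≤ D`), `roundPoly` (the honest message: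
  the partial-sum polynomial of the next coordinate; `eval_roundPoly`, `natDegree_roundPoly_le`,
  `sum_roundPoly`);
* `chain`, `Accepts` — the verifier's checks against a message sequence `s₀, s₁, …` and challenges
  `r`: degrees `≤ D`, `∑_{a ∈ H} sᵢ(a) =` previous value, and finally `Φ(r) =` last value;
* **`soundness`** (deterministic form, AB Thm. 8.21, Claim): if the claimed value is wrong and all
  checks pass then some round `i` has `sᵢ ≠ hᵢ` with `rᵢ` a root of `sᵢ - hᵢ`;
  **`completeness`**: the honest messages pass with the true value;
* **`card_accepts_mul_le`** (the counting form for an ADAPTIVE table `S : prefix ↦ message`): the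
  challenge vectors `r ∈ Fᴷ` on which a wrong claim is accepted number at most `K · D · |F|ᴷ / |F|`
  (stated as `#accepted · |F| ≤ K · D · |F|ᴷ`), by the root bound for nonzero polynomials of degree
  `≤ D` in each round and an injection `(r, a) ↦ (r[i ↦ a], rᵢ)`.

## References

* C. Lund, L. Fortnow, H. Karloff, N. Nisan, *Algebraic methods for interactive proof systems*,
  J. ACM 39 (1992) (the sumcheck protocol) [LFKN1992].
* L. Babai, L. Fortnow, C. Lund, *Non-deterministic exponential time has two-prover interactive
  protocols*, Comput. Complexity 1 (1991), §4 (the protocol with an oracle, sums over `Hᵐ`)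
  [BabaiFortnowLund1991].
* S. Arora, B. Barak, *Computational Complexity: A Modern Approach*, CUP 2009, §8.3.2, Thm. 8.21 and
  its Claim (soundness `(1 - d/p)ⁿ`), §8.6 [AroraBarakCC2009].
-/

noncomputable section

open Finset Polynomial

namespace Literature.Computability.Complexity

namespace SumcheckF

variable {F : Type*}

/-! ### Sums over `Hᵗ` -/

section CubeSum

variable {M : Type*} [AddCommMonoid M]

/-- `cubeSum H t G = ∑_{c ∈ Hᵗ} G(c)`, the coordinates of `c` listed first-to-last.
[cite: AroraBarakCC2009, §8.3.2] -/
def cubeSum (H : Finset F) : ℕ → (List F → M) → M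
  | 0, G => G []
  | t + 1, G => ∑ a ∈ H, cubeSum H t fun l => G (a :: l)

/-- `cubeSum` over `H⁰` is the value at the empty list. [folklore] -/
@[simp] theorem cubeSum_zero (H : Finset F) (G : List F → M) : cubeSum H 0 G = G [] := rfl

/-- Peeling the first coordinate. [folklore] -/
theorem cubeSum_succ (H : Finset F) (t : ℕ) (G : List F → M) :
    cubeSum H (t + 1) G = ∑ a ∈ H, cubeSum H t fun l => G (a :: l) := rfl

/-- `cubeSum` only reads lists of length `t`. [folklore] -/
theorem cubeSum_congr (H : Finset F) :
    ∀ (t : ℕ) {G G' : List F → M}, (∀ l : List F, l.length = t → G l = G' l) → cubeSum H t G = cubeSum H t G'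
  | 0, _, _, h => h [] rfl
  | t + 1, _, _, h => by
    rw [cubeSum_succ, cubeSum_succ]
    exact sum_congr rfl fun a _ => cubeSum_congr H t fun l hl => h (a :: l) (by simp [hl])

/-- `cubeSum` commutes with additive maps. [folklore] -/
theorem map_cubeSum {N : Type*} [AddCommMonoid N] (φ : M →+ N) (H : Finset F) :
    ∀ (t : ℕ) (G : List F → M), φ (cubeSum H t G) = cubeSum H t fun l => φ (G l)
  | 0, _ => rfl
  | t + 1, G => by
    rw [cubeSum_succ, cubeSum_succ, map_sum]
    exact sum_congr rfl fun a _ => map_cubeSum φ H t _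

/-- `cubeSum` of a finite sum of functions. [folklore] -/
theorem cubeSum_finset_sum {ι : Type*} (H : Finset F) (s : Finset ι) :
    ∀ (t : ℕ) (G : ι → List F → M), cubeSum H t (fun l => ∑ i ∈ s, G i l) = ∑ i ∈ s, cubeSum H t (G i)
  | 0, _ => rfl
  | t + 1, G => by
    simp only [cubeSum_succ]
    rw [sum_comm]
    exact sum_congr rfl fun a _ => cubeSum_finset_sum H s t _

end CubeSum

section OverField

variable [Field F]

/-- A bound on the degree of a `cubeSum` of polynomials. [folklore] -/
theorem natDegree_cubeSum_le (H : Finset F) {D : ℕ} :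
    ∀ (t : ℕ) {G : List F → F[X]}, (∀ l, (G l).natDegree ≤ D) → (cubeSum H t G).natDegree ≤ D
  | 0, _, h => h []
  | t + 1, _, h => by
    rw [cubeSum_succ]
    exact natDegree_sum_le_of_forall_le _ _ fun a _ => natDegree_cubeSum_le H t fun l => h (a :: l)

/-! ### Partial sums, coordinatewise low degree, the honest messages -/

section Protocol

variable (H : Finset F) (Φ : List F → F) (K D : ℕ)

/-- The partial sum with the prefix `pref` fixed: `∑_{c ∈ H^{K - |pref|}} Φ(pref ++ c)`
(AB (8.7)/(8.9)). [cite: AroraBarakCC2009, §8.3.2] -/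
def psum (pref : List F) : F := cubeSum H (K - pref.length) fun c => Φ (pref ++ c)

/-- **Coordinatewise degree `≤ D`**: in each coordinate, with all other coordinates fixed, `Φ` is a
one-variable polynomial function of degree `≤ D` (the hypothesis "`g` is a degree `d` polynomial in
each variable" of the general sumcheck). [cite: AroraBarakCC2009, §8.3.2] -/
structure AxisPoly : Prop where
  /-- in each coordinate `Φ` is a polynomial function of degree `≤ D` -/
  poly : ∀ pref suff : List F, pref.length + suff.length + 1 = K →
    ∃ P : F[X], P.natDegree ≤ D ∧ ∀ a : F, Φ (pref ++ a :: suff) = P.eval a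

variable {H Φ K D}

/-- The one-variable polynomial of `Φ` in the coordinate after `pref`, the later coordinates being
`suff` (zero off the admissible lengths). [folklore] -/
def slicePoly (hΦ : AxisPoly Φ K D) (pref suff : List F) : F[X] :=
  if h : pref.length + suff.length + 1 = K then Classical.choose (hΦ.poly pref suff h) else 0

/-- Degree of a slice polynomial. [folklore] -/
theorem natDegree_slicePoly_le (hΦ : AxisPoly Φ K D) (pref suff : List F) :
    (slicePoly hΦ pref suff).natDegree ≤ D := by
  unfold slicePoly
  split_ifs with h
  · exact (Classical.choose_spec (hΦ.poly pref suff h)).1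
  · simp

/-- Value of a slice polynomial. [folklore] -/
theorem eval_slicePoly (hΦ : AxisPoly Φ K D) {pref suff : List F}
    (h : pref.length + suff.length + 1 = K) (a : F) :
    (slicePoly hΦ pref suff).eval a = Φ (pref ++ a :: suff) := by
  unfold slicePoly
  rw [dif_pos h]
  exact ((Classical.choose_spec (hΦ.poly pref suff h)).2 a).symm

variable (H) in
/-- **The honest round message** after the challenge prefix `pref`: the polynomial
`h(X) = ∑_{c ∈ H^{K-|pref|-1}} Φ(pref, X, c)` (AB (8.9)). [cite: AroraBarakCC2009, §8.3.2] -/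
def roundPoly (hΦ : AxisPoly Φ K D) (pref : List F) : F[X] :=
  cubeSum H (K - pref.length - 1) fun c => slicePoly hΦ pref c

/-- The honest message has degree `≤ D`. [cite: AroraBarakCC2009, §8.3.2] -/
theorem natDegree_roundPoly_le (hΦ : AxisPoly Φ K D) (pref : List F) :
    (roundPoly H hΦ pref).natDegree ≤ D :=
  natDegree_cubeSum_le H _ fun c => natDegree_slicePoly_le hΦ pref c

/-- **The honest message evaluates to the next partial sum**: `h(a) = psum (pref ++ [a])` for
`|pref| < K` (AB: "`h(X₁) = ∑ g(X₁, b₂, …, bₙ)`"). [cite: AroraBarakCC2009, §8.3.2] -/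
theorem eval_roundPoly (hΦ : AxisPoly Φ K D) {pref : List F} (hlen : pref.length < K) (a : F) :
    (roundPoly H hΦ pref).eval a = psum H Φ K (pref ++ [a]) := by
  unfold roundPoly psum
  rw [← coe_evalRingHom, show ((evalRingHom a) (cubeSum H (K - pref.length - 1) fun c => slicePoly hΦ pref c)) =
      (evalRingHom a).toAddMonoidHom (cubeSum H (K - pref.length - 1) fun c => slicePoly hΦ pref c) from rfl,
    map_cubeSum]
  have hl : K - (pref ++ [a]).length = K - pref.length - 1 := by simp; omega
  rw [hl]
  refine cubeSum_congr H _ fun l hlK => ?_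
  simp only [RingHom.toAddMonoidHom_eq_coe, AddMonoidHom.coe_coe, coe_evalRingHom, List.append_assoc,
    List.singleton_append]
  exact eval_slicePoly hΦ (by omega) a

/-- The partial sums satisfy the recursion `psum pref = ∑_{a ∈ H} psum (pref ++ [a])` for
`|pref| < K`. [cite: AroraBarakCC2009, §8.3.2] -/
theorem psum_eq_sum {pref : List F} (hlen : pref.length < K) :
    psum H Φ K pref = ∑ a ∈ H, psum H Φ K (pref ++ [a]) := by
  unfold psum
  obtain ⟨t, ht⟩ : ∃ t, K - pref.length = t + 1 := ⟨K - pref.length - 1, by omega⟩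
  rw [ht, cubeSum_succ]
  refine sum_congr rfl fun a _ => ?_
  have hl : K - (pref ++ [a]).length = t := by simp; omega
  rw [hl]
  exact cubeSum_congr H t fun l _ => by rw [List.append_assoc, List.singleton_append]

/-- The partial sum with a full prefix is the value. [folklore] -/
theorem psum_of_length_eq {pref : List F} (hlen : pref.length = K) : psum H Φ K pref = Φ pref := by
  unfold psum
  rw [hlen, Nat.sub_self, cubeSum_zero, List.append_nil]

/-- **`∑_{a ∈ H} h(a) =` the current partial sum** (the identity checked by the verifier, for the
honest message). [cite: AroraBarakCC2009, §8.3.2] -/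
theorem sum_roundPoly (hΦ : AxisPoly Φ K D) {pref : List F} (hlen : pref.length < K) :
    ∑ a ∈ H, (roundPoly H hΦ pref).eval a = psum H Φ K pref := by
  rw [psum_eq_sum hlen]
  exact sum_congr rfl fun a _ => eval_roundPoly hΦ hlen a

/-! ### The verifier's checks -/

/-- The chain of claimed values: `v₀ = v` and `vᵢ₊₁ = sᵢ(rᵢ)`. [cite: AroraBarakCC2009, §8.3.2] -/
def chain (v : F) (s : ℕ → F[X]) (r : List F) : ℕ → F
  | 0 => v
  | i + 1 => (s i).eval (r.getD i 0)

variable (H Φ K D) in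
/-- **Arthur's checks** against the messages `s₀, s₁, …` and the challenges `r`: every message has
degree `≤ D` and sums over `H` to the current claimed value, and at the end `Φ(r)` is the last
claimed value. [cite: AroraBarakCC2009, §8.3.2 (Thm. 8.21, protocol)] -/
structure Accepts (v : F) (s : ℕ → F[X]) (r : List F) : Prop where
  /-- degree checks -/
  deg : ∀ i, i < K → (s i).natDegree ≤ D
  /-- `∑_{a ∈ H} sᵢ(a) = vᵢ` -/
  sum : ∀ i, i < K → ∑ a ∈ H, (s i).eval a = chain v s r i
  /-- the final evaluation of the summand -/
  final : Φ r = chain v s r K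

/-- `r ↾ (i+1) = (r ↾ i) ++ [rᵢ]` inside the list. [folklore] -/
theorem take_succ_eq (r : List F) {i : ℕ} (hi : i < r.length) : r.take (i + 1) = r.take i ++ [r.getD i 0] := by
  rw [List.take_add_one, List.getD_eq_getElem?_getD, List.getElem?_eq_getElem hi]
  rfl

/-- **Soundness of the sumcheck protocol** (deterministic form of the Claim in AB Thm. 8.21): if the
claimed value `v` is NOT `∑_{c ∈ Hᴷ} Φ(c)` and all checks pass, then in some round `i < K` the
message `sᵢ` differs from the honest message `hᵢ` at the actual prefix `r ↾ i`, while the challenge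
`rᵢ` is a root of `sᵢ - hᵢ` — by induction, a wrong claimed value `vᵢ ≠ psum (r ↾ i)` forces
`sᵢ ≠ hᵢ` (their sums over `H` differ) and then either `rᵢ` is a root or `vᵢ₊₁` is wrong again; the
final check excludes a wrong `v_K`. [cite: AroraBarakCC2009, Thm. 8.21 (proof, Claim)] -/
theorem soundness (hΦ : AxisPoly Φ K D) {v : F} {s : ℕ → F[X]} {r : List F} (hr : r.length = K)
    (hacc : Accepts H Φ K D v s r) (hv : psum H Φ K [] ≠ v) :
    ∃ i, i < K ∧ s i ≠ roundPoly H hΦ (r.take i) ∧ (s i - roundPoly H hΦ (r.take i)).IsRoot (r.getD i 0) := by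
  by_contra hno
  simp only [not_exists, not_and] at hno
  -- a wrong claimed value propagates to the end
  have key : ∀ i, i ≤ K → chain v s r i ≠ psum H Φ K (r.take i) := by
    intro i
    induction i with
    | zero =>
      intro _
      show v ≠ psum H Φ K (r.take 0)
      rw [List.take_zero]
      exact hv.symm
    | succ i ih =>
      intro hi
      have hi' : i < K := Nat.lt_of_succ_le hi
      have hprev := ih hi'.le
      have hlen : (r.take i).length = i := by rw [List.length_take]; omega
      have hlt : (r.take i).length < K := by rw [hlen]; exact hi'
      -- the messages differ
      have hne : s i ≠ roundPoly H hΦ (r.take i) := by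
        intro heq
        apply hprev
        rw [← hacc.sum i hi', heq, sum_roundPoly hΦ hlt]
      -- so `rᵢ` is not a root, and the next claimed value is wrong again
      have hroot := hno i hi' hne
      rw [IsRoot.def, eval_sub, sub_eq_zero] at hroot
      show (s i).eval (r.getD i 0) ≠ psum H Φ K (r.take (i + 1))
      rw [take_succ_eq r (by omega), ← eval_roundPoly hΦ hlt]
      exact hroot
  have hK := key K le_rfl
  rw [List.take_of_length_le hr.le, psum_of_length_eq hr] at hK
  exact hK hacc.final.symm

/-- **Completeness of the sumcheck protocol**: with the true value and the honest messages every
check passes. [cite: AroraBarakCC2009, Thm. 8.21 (proof)] -/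
theorem completeness (hΦ : AxisPoly Φ K D) {r : List F} (hr : r.length = K) :
    Accepts H Φ K D (psum H Φ K []) (fun i => roundPoly H hΦ (r.take i)) r := by
  have hchain : ∀ i, i ≤ K → chain (psum H Φ K []) (fun i => roundPoly H hΦ (r.take i)) r i = psum H Φ K (r.take i) := by
    intro i
    induction i with
    | zero => intro _; simp [chain]
    | succ i ih =>
      intro hi
      have hlt : (r.take i).length < K := by rw [List.length_take]; omega
      show (roundPoly H hΦ (r.take i)).eval (r.getD i 0) = psum H Φ K (r.take (i + 1))
      rw [eval_roundPoly hΦ hlt, take_succ_eq r (by omega)]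
  refine ⟨fun i _ => natDegree_roundPoly_le hΦ _, fun i hi => ?_, ?_⟩
  · rw [hchain i hi.le]
    exact sum_roundPoly hΦ (by rw [List.length_take]; omega)
  · rw [hchain K le_rfl, List.take_of_length_le hr.le, psum_of_length_eq hr]

end Protocol

/-! ### Closure properties of coordinatewise low degree -/

section AxisPolyAPI

variable {Φ Ψ : List F → F} {K D D' : ℕ}

/-- Constants are coordinatewise of degree `≤ D`. [folklore] -/
theorem AxisPoly.const (K D : ℕ) (c : F) : AxisPoly (fun _ : List F => c) K D :=
  ⟨fun _ _ _ => ⟨Polynomial.C c, (natDegree_C c).le.trans (Nat.zero_le _), fun a => by simp⟩⟩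

/-- Sums of coordinatewise low-degree functions. [folklore] -/
theorem AxisPoly.add (hΦ : AxisPoly Φ K D) (hΨ : AxisPoly Ψ K D) : AxisPoly (fun l => Φ l + Ψ l) K D := by
  refine ⟨fun pref suff h => ?_⟩
  obtain ⟨P, hP, hPe⟩ := hΦ.poly pref suff h
  obtain ⟨Q, hQ, hQe⟩ := hΨ.poly pref suff h
  exact ⟨P + Q, (natDegree_add_le _ _).trans (max_le hP hQ), fun a => by simp only [hPe, hQe, eval_add]⟩

/-- Products of coordinatewise low-degree functions (degrees add). [folklore] -/
theorem AxisPoly.mul (hΦ : AxisPoly Φ K D) (hΨ : AxisPoly Ψ K D') : AxisPoly (fun l => Φ l * Ψ l) K (D + D') := by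
  refine ⟨fun pref suff h => ?_⟩
  obtain ⟨P, hP, hPe⟩ := hΦ.poly pref suff h
  obtain ⟨Q, hQ, hQe⟩ := hΨ.poly pref suff h
  exact ⟨P * Q, natDegree_mul_le.trans (Nat.add_le_add hP hQ), fun a => by simp only [hPe, hQe, eval_mul]⟩

/-- Weakening the degree bound. [folklore] -/
theorem AxisPoly.mono (hΦ : AxisPoly Φ K D) (hD : D ≤ D') : AxisPoly Φ K D' :=
  ⟨fun pref suff h => by
    obtain ⟨P, hP, hPe⟩ := hΦ.poly pref suff h
    exact ⟨P, hP.trans hD, hPe⟩⟩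

/-- Finite sums of coordinatewise low-degree functions. [folklore] -/
theorem AxisPoly.finset_sum {ι : Type*} (s : Finset ι) {G : ι → List F → F} (hG : ∀ i ∈ s, AxisPoly (G i) K D) :
    AxisPoly (fun l => ∑ i ∈ s, G i l) K D := by
  classical
  induction s using Finset.induction_on with
  | empty => simpa using AxisPoly.const K D (0 : F)
  | insert a s ha ih =>
    have h := (hG a (mem_insert_self a s)).add (ih fun i hi => hG i (mem_insert_of_mem hi))
    simpa [sum_insert ha] using h

/-- A one-variable polynomial of degree `≤ D` read at a fixed coordinate is coordinatewise of degree
`≤ D` (the building block of arithmetized constraints). [folklore] -/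
theorem AxisPoly.coord (K D : ℕ) {P : F[X]} (hP : P.natDegree ≤ D) (t : ℕ) :
    AxisPoly (fun l : List F => P.eval (l.getD t 0)) K D := by
  refine ⟨fun pref suff h => ?_⟩
  rcases lt_trichotomy t pref.length with ht | ht | ht
  · refine ⟨Polynomial.C (P.eval (pref.getD t 0)), (natDegree_C _).le.trans (Nat.zero_le _), fun a => ?_⟩
    show P.eval ((pref ++ a :: suff).getD t 0) = _
    rw [eval_C]
    simp only [List.getD_eq_getElem?_getD]
    rw [List.getElem?_append_left (by simpa using ht)]
  · refine ⟨P, hP, fun a => ?_⟩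
    show P.eval ((pref ++ a :: suff).getD t 0) = _
    rw [List.getD_eq_getElem?_getD, List.getElem?_append_right (by omega), ht, Nat.sub_self]
    rfl
  · refine ⟨Polynomial.C (P.eval (suff.getD (t - pref.length - 1) 0)), (natDegree_C _).le.trans (Nat.zero_le _),
      fun a => ?_⟩
    show P.eval ((pref ++ a :: suff).getD t 0) = _
    rw [eval_C]
    simp only [List.getD_eq_getElem?_getD]
    rw [List.getElem?_append_right (by omega)]
    obtain ⟨u, hu⟩ : ∃ u, t - pref.length = u + 1 := ⟨t - pref.length - 1, by omega⟩
    rw [hu, List.getElem?_cons_succ, Nat.add_sub_cancel]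

end AxisPolyAPI

end OverField

/-! ### Counting: an adaptive table fools few challenge vectors -/

section Plain

variable {K : ℕ}

/-- Reading a challenge vector as a list. [folklore] -/
theorem getD_ofFn [Zero F] (ρ : Fin K → F) (i : Fin K) : (List.ofFn ρ).getD i 0 = ρ i := by
  rw [List.getD_eq_getElem?_getD, List.getElem?_eq_getElem (by simp), Option.getD_some, List.getElem_ofFn]

/-- The prefix of length `i` of a challenge vector does not see coordinate `i`. [folklore] -/
theorem take_ofFn_update [DecidableEq (Fin K)] (ρ : Fin K → F) (i : Fin K) (a : F) :
    (List.ofFn (Function.update ρ i a)).take i = (List.ofFn ρ).take i := by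
  apply List.ext_getElem
  · simp
  · intro n h₁ h₂
    simp only [List.getElem_take, List.getElem_ofFn]
    rw [Function.update_of_ne]
    intro h
    have : n < (i : ℕ) := by simpa using h₁
    exact absurd (congrArg Fin.val h) (by simp; omega)

end Plain

section Counting

variable [Field F] [Fintype F] [DecidableEq F]
variable {H : Finset F} {Φ : List F → F} {K D : ℕ}

/-- **Root bound for one round**: for a polynomial `g(ρ)` of degree `≤ D` attached to every
challenge vector, nonzero and not depending on the coordinate `i`, the vectors with `ρᵢ` a root of
`g(ρ)` satisfy `#{ρ | g(ρ)(ρᵢ) = 0} · |F| ≤ D · |F|ᴷ` — the map `(ρ, a) ↦ (ρ[i ↦ a], ρᵢ)` is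
injective into the pairs `(ρ', b)` with `b` a root of `g(ρ')`. [cite: AroraBarakCC2009, Thm. 8.21 (proof: "at most `d` roots")] -/
theorem card_root_mul_le (i : Fin K) (g : (Fin K → F) → F[X])
    (hdep : ∀ (ρ : Fin K → F) (a : F), g (Function.update ρ i a) = g ρ)
    (hdeg : ∀ ρ, (g ρ).natDegree ≤ D) :
    (univ.filter fun ρ : Fin K → F => g ρ ≠ 0 ∧ (g ρ).IsRoot (ρ i)).card * Fintype.card F ≤
      D * Fintype.card F ^ K := by
  classical
  set S := univ.filter fun ρ : Fin K → F => g ρ ≠ 0 ∧ (g ρ).IsRoot (ρ i) with hS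
  set T := (univ : Finset ((Fin K → F) × F)).filter fun q => g q.1 ≠ 0 ∧ (g q.1).IsRoot q.2 with hT
  -- the injection
  have hinj : ((S ×ˢ (univ : Finset F)).image fun q => (Function.update q.1 i q.2, q.1 i)).card =
      S.card * Fintype.card F := by
    rw [card_image_of_injOn, card_product, card_univ]
    rintro ⟨ρ, a⟩ - ⟨ρ', a'⟩ - h
    simp only [Prod.mk.injEq] at h
    obtain ⟨h1, h2⟩ := h
    have hρ : ρ = ρ' := by
      have := congrArg (fun τ => Function.update τ i (ρ i)) h1
      simp only [Function.update_idem, Function.update_eq_self] at this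
      rw [this, h2, Function.update_eq_self]
    subst hρ
    have := congrFun h1 i
    simp only [Function.update_self] at this
    exact Prod.ext rfl this
  have hsub : ((S ×ˢ (univ : Finset F)).image fun q => (Function.update q.1 i q.2, q.1 i)) ⊆ T := by
    intro q hq
    rw [mem_image] at hq
    obtain ⟨⟨ρ, a⟩, hρa, rfl⟩ := hq
    rw [mem_product] at hρa
    have hρ := (mem_filter.1 hρa.1).2
    rw [hT, mem_filter]
    refine ⟨mem_univ _, ?_⟩
    simp only [hdep]
    exact hρ
  -- counting the pairs `(ρ', b)` with `b` a root
  have hTcard : T.card ≤ D * Fintype.card F ^ K := by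
    rw [hT, card_eq_sum_card_fiberwise (f := fun q : (Fin K → F) × F => q.1) (t := univ) fun _ _ => mem_univ _]
    calc ∑ ρ : Fin K → F, ((univ.filter fun q : (Fin K → F) × F => g q.1 ≠ 0 ∧ (g q.1).IsRoot q.2).filter
          fun q => q.1 = ρ).card
        ≤ ∑ _ρ : Fin K → F, D := sum_le_sum fun ρ _ => ?_
      _ = D * Fintype.card F ^ K := by rw [sum_const, card_univ, smul_eq_mul, Fintype.card_fun,
          Fintype.card_fin, mul_comm]
    by_cases hg : g ρ = 0
    · have : ((univ.filter fun q : (Fin K → F) × F => g q.1 ≠ 0 ∧ (g q.1).IsRoot q.2).filter fun q => q.1 = ρ) = ∅ := by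
        ext q
        simp only [mem_filter, mem_univ, true_and, notMem_empty, iff_false, not_and]
        rintro ⟨h1, -⟩ rfl
        exact h1 hg
      rw [this, card_empty]
      exact Nat.zero_le _
    · calc ((univ.filter fun q : (Fin K → F) × F => g q.1 ≠ 0 ∧ (g q.1).IsRoot q.2).filter fun q => q.1 = ρ).card
          ≤ ((g ρ).roots.toFinset.image fun b => (ρ, b)).card := card_le_card fun q hq => by
            simp only [mem_filter, mem_univ, true_and] at hq
            obtain ⟨⟨-, hroot⟩, rfl⟩ := hq
            rw [mem_image]
            exact ⟨q.2, Multiset.mem_toFinset.2 ((mem_roots hg).2 hroot), rfl⟩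
        _ ≤ (g ρ).roots.toFinset.card := card_image_le
        _ ≤ (g ρ).roots.card := Multiset.toFinset_card_le _
        _ ≤ (g ρ).natDegree := card_roots' _
        _ ≤ D := hdeg ρ
  calc S.card * Fintype.card F
      = ((S ×ˢ (univ : Finset F)).image fun q => (Function.update q.1 i q.2, q.1 i)).card := hinj.symm
    _ ≤ T.card := card_le_card hsub
    _ ≤ D * Fintype.card F ^ K := hTcard

open scoped Classical in
/-- **The counting form of soundness for an adaptive table.** Let the prover be a table
`S : prefix ↦ message`. If the claimed value is wrong, the challenge vectors `ρ ∈ Fᴷ` on which all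
checks pass number at most `K · D · |F|ᴷ⁻¹`: each accepted `ρ` has a round `i` with `ρᵢ` a root of
the nonzero polynomial `S(ρ ↾ i) - hᵢ(ρ ↾ i)` of degree `≤ D`, which does not depend on `ρᵢ`
(`card_root_mul_le`). [cite: AroraBarakCC2009, Thm. 8.21 (soundness `1 - (1 - d/p)ⁿ ≤ dn/p`)] -/
theorem card_accepts_mul_le (hΦ : AxisPoly Φ K D) {v : F} (hv : psum H Φ K [] ≠ v) (S : List F → F[X]) :
    (univ.filter fun ρ : Fin K → F =>
        Accepts H Φ K D v (fun i => S ((List.ofFn ρ).take i)) (List.ofFn ρ)).card * Fintype.card F ≤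
      K * D * Fintype.card F ^ K := by
  classical
  -- the bad event of round `i`
  set g : Fin K → (Fin K → F) → F[X] := fun i ρ =>
    (if (S ((List.ofFn ρ).take i)).natDegree ≤ D then S ((List.ofFn ρ).take i) else 0) -
      roundPoly H hΦ ((List.ofFn ρ).take i) with hg
  have hdep : ∀ (i : Fin K) (ρ : Fin K → F) (a : F), g i (Function.update ρ i a) = g i ρ := by
    intro i ρ a
    simp only [hg, take_ofFn_update]
  have hdeg : ∀ (i : Fin K) (ρ : Fin K → F), (g i ρ).natDegree ≤ D := by
    intro i ρ
    simp only [hg]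
    refine (natDegree_sub_le _ _).trans (max_le ?_ (natDegree_roundPoly_le hΦ _))
    split_ifs with h
    · exact h
    · simp
  have hsub : (univ.filter fun ρ : Fin K → F =>
      Accepts H Φ K D v (fun i => S ((List.ofFn ρ).take i)) (List.ofFn ρ)) ⊆
      (univ : Finset (Fin K)).biUnion fun i => univ.filter fun ρ : Fin K → F => g i ρ ≠ 0 ∧ (g i ρ).IsRoot (ρ i) := by
    intro ρ hρ
    have hacc := (mem_filter.1 hρ).2
    obtain ⟨i, hi, hne, hroot⟩ := soundness hΦ (List.length_ofFn (f := ρ)) hacc hv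
    rw [mem_biUnion]
    refine ⟨⟨i, hi⟩, mem_univ _, mem_filter.2 ⟨mem_univ _, ?_⟩⟩
    have hgi : g ⟨i, hi⟩ ρ = S ((List.ofFn ρ).take i) - roundPoly H hΦ ((List.ofFn ρ).take i) := by
      simp only [hg, if_pos (hacc.deg i hi)]
    rw [hgi, ← getD_ofFn ρ ⟨i, hi⟩]
    exact ⟨sub_ne_zero.2 hne, hroot⟩
  calc (univ.filter fun ρ : Fin K → F =>
        Accepts H Φ K D v (fun i => S ((List.ofFn ρ).take i)) (List.ofFn ρ)).card * Fintype.card F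
      ≤ ((univ : Finset (Fin K)).biUnion fun i =>
          univ.filter fun ρ : Fin K → F => g i ρ ≠ 0 ∧ (g i ρ).IsRoot (ρ i)).card * Fintype.card F :=
        Nat.mul_le_mul_right _ (card_le_card hsub)
    _ ≤ (∑ i : Fin K, (univ.filter fun ρ : Fin K → F => g i ρ ≠ 0 ∧ (g i ρ).IsRoot (ρ i)).card) * Fintype.card F :=
        Nat.mul_le_mul_right _ card_biUnion_le
    _ = ∑ i : Fin K, (univ.filter fun ρ : Fin K → F => g i ρ ≠ 0 ∧ (g i ρ).IsRoot (ρ i)).card * Fintype.card F :=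
        sum_mul _ _ _
    _ ≤ ∑ _i : Fin K, D * Fintype.card F ^ K := sum_le_sum fun i _ => card_root_mul_le i (g i) (hdep i) (hdeg i)
    _ = K * D * Fintype.card F ^ K := by rw [sum_const, card_univ, Fintype.card_fin, smul_eq_mul, mul_assoc]

end Counting

end SumcheckF

end Literature.Computability.Complexity

end
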